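import Literature.MathematicalPhysics.QuantumFieldTheory.Balaban1983to89.B8Eq151V2Divergence

/-!
# `Balaban1983to89.B11Eq93Commutator` — T. Bałaban, *The variational problem and background fields in renormalization group method for lattice gauge theories*, Commun. Math. Phys. **102** (1985) 277–309 [Balaban1985Variational]: (91), (93)–(96) p. 292 — the commutator term `½D*Σi[A″, A″]` of the first functional derivative of `V(A′)` (proof of Prop. 4), via (1.50), (1.52) of [6] = [Balaban1985RegularSpaces], PROVED on the `ℤ^d` carrier of `B8Eq151V2Divergence`

statement-level skeleton of published theorems with citation tags; proofs where landed; nothing here is a claim about the Yang–Mills mass gap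

PDF held: `paper:balaban1985-cmp102-variational-background` (journal page = PDF page + 276).  Render
`run/shared/lean/pub/pub-balaban/b2b-balaban-ref1/pages/1985-cmp102-variational-background/…-p016-x2.png` (p. 292)
READ AS AN IMAGE by this seat (lit-balaban reader/typer r08, gen 2, 2026-08-21).

CITATION HEADER (lean-in-tree rule 2026-08-18).  WHAT IS REPRODUCED: SKELETON row `B11.Eq85` = the termwise estimates
(85)–(96) of `(δ/δA′)V` on pp. 291–292, its LAST TERM (91)–(96) (p. 292 from «A typical term is» to «can be estimated
by O(1)|∇A′||A′| also»); the four other terms (85)–(90) and the differentiation rule (92) are the sibling module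
`B11Eq85FirstDerivative`; the gathering of the five termwise bounds into Prop. 4 (97) is `B11Smallness.prop4_gathering`.

THE PRINT (p. 292 [PDF 16], verbatim).  «Let us consider the terms with the derivative acting on A′. A typical term is
  Σ_{p∈Ω₀} η^d ½ tr(DA′)(p) Σ_{b₁≺b₂} i[A″(b₁), A″(b₂)] = ½⟨DA′, Σi[A″, A″]⟩, (91)
the other terms are obtained by replacing some A′ in the commutator by −HD(A′). The functional differentiation gives
three terms ½⟨DδA′, Σi[A″, A″]⟩ + ½⟨DA′, Σi([δA″, A″] + [A″, δA″])⟩, (92) and the functional derivatives connected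
with the second and third terms are estimated easily by O(1)|DA′||A′|. We transform the first term integrating by
parts, and we get the functional derivative given by
  ½D*Σi[A″, A″]. (93)
This expression was already investigated in Sect. C of [6]. Let us recall that for a plaquette p = ⟨x, x + ηe_μ,
x + ηe_μ + ηe_ν, x + ηe_ν⟩, μ < ν, we have by (1.50) of that paper
  Σ_{b₁≺b₂} i[A″(b₁), A″(b₂)] = 2i[A′_μ(x), A′_ν(x)] + 2iη[A′_μ(x), (D_μA′_ν)(x)] + 2iη[(D_νA′_μ)(x), A′_ν(x)]
    − iη[A′_μ(x), (D_νA′_μ)(x)] − iη[(D_μA′_ν)(x), A′_ν(x)] − iη²[(D_μA′_ν)(x), (D_νA′_μ)(x)]. (94)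
If we apply the derivative D* to all the terms on the right-hand side of the above equation except the first, then we
can use the factor η to replace this derivative by a simple difference operation. Thus these terms in (93) can be
estimated by O(1)|∇A′||A′|. Applying D* to the first term gives the expression
  i Σ_{ν<μ} (D*_ν[A′_ν, A′_μ])(x) − i Σ_{ν>μ} (D*_ν[A′_μ, A′_ν])(x). (95)
Further let us recall the formula (1.52) from [6]:
  (D*_ν[A′_μ, A′_ν])(x) = η[(D*_νA′_μ)(x), (D*_νA′_ν)(x)] + [(D*_νA′_μ)(x), A′_ν(x)] + [A′_μ(x), (D*_νA′_ν)(x)]. (96)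
From this it follows that the expression (95) can be estimated by O(1)|∇A′||A′| also.»

DICTIONARY (the `ℤ^d` model of `B8Eq151V2Divergence` / `B8Eq146AExpansion` / `B8Ineq132`; nothing re-declared).
`A′` ↦ a bond field `A : Site d → Fin d → 𝔸` over a normed `ℂ`-algebra `𝔸` (`A x μ = A′_μ(x) = A′(⟨x, x + ηe_μ⟩)`),
ARBITRARY (print: values in the complexified Lie algebra); the background `U₀` is `U1`-valued (`‖u‖, ‖u⁻¹‖ ≤ 1`) where
norms are taken; `D_μ = D^η_{U₀,μ}` ↦ `covDerivFwd η U₀ μ`, `D*_ν = D^{η*}_{U₀,ν}` ↦ `covDeriv η U₀ ν`, `D*` on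
plaquette functions ((1.2) of [6]) ↦ `pdiv η U₀`, `(DA′)(p)` ↦ `plaqCovDeriv η U₀ A μ ν x`; the transported bond
variables `A″(b₁), …, A″(b₄)` of `p_{μν}(x)` («the "primes" in this expression … are connected with an application of
the operators R(U₀). Now we denote the corresponding expressions by A″») ↦ `X1 … X4`, so `Σ_{b₁≺b₂}[A″(b₁), A″(b₂)]`
↦ `brk U₀ A μ ν x` and `Σ_{b₁≺b₂} i[A″(b₁), A″(b₂)]` ↦ **`icomm U₀ A μ ν x = I • brk U₀ A μ ν x`**; its first term
`2i[A′_μ(x), A′_ν(x)]` ↦ `I • brk0 A μ ν x`; `|A′| ≤ a`, `|∇A′| ≤ G` ↦ the uniform bounds `hA`, `hG` of [6]'s modules;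
«tr» ↦ an arbitrary `ℂ`-linear functional `τ` (enters (91) only); `Ω₀` ↦ a finite set `P` of plaquettes `(μ, ν, x)`.

WHAT IS CERTIFIED (kernel, sorry-free; axioms `propext` / `Classical.choice` / `Quot.sound`).  `eq91` (the pairing
identity (91), by distributivity); **(94)** = `I •` (1.50) (`eq94`, from `B8Eq151V2Divergence.eq150`); **(96)** =
(1.52) at print's letters (`eq96` = `eq152`); **(95)** EXACTLY: `½D*(2i[A′_·, A′_·])_μ(x) = iΣ_{ν<μ}(D*_ν[A′_ν,
A′_μ])(x) − iΣ_{ν>μ}(D*_ν[A′_μ, A′_ν])(x)` (`eq95`); the two «O(1)|∇A′||A′|» sentences with the O(1) explicit: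
`‖(95)‖ ≤ 8(d − 1)·a·G` (`norm_fd95_le`, from (96) termwise = `norm_covDeriv_adR_le`), «these terms in (93)» = `½D*`
of the five `η`-terms of (94): `≤ 16(d − 1)·a·G` (`norm_fd93_sub_fd95_le`; per plaquette the five terms are
`≤ (4 + 4 + 2 + 2 + 4)ηaG`, `norm_brk_sub_brk0_le`, and `|D*_νF(x)| ≤ η⁻¹(|F(x − e_ν)| + |F(x)|)` «replace[s] this
derivative by a simple difference operation»), hence **(93)**: `‖½D*Σi[A″, A″]_μ(x)‖ ≤ 24(d − 1)·a·G` (`norm_fd93_le`)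
and, under (77) `|A′| ≤ ε₃(Lʲη)⁻¹`, `|∇A′| ≤ ε₃(Lʲη)⁻²`: `≤ 24(d − 1)ε₃²(Lʲη)⁻³` (`norm_fd93_le_eps3`) — the
`K₅ε₃²`-shape gathered into (97) by `B11Smallness.prop4_gathering`.

HONEST SCOPE — what is NOT claimed.  (i) (92) and the integration by parts (92) → (93) are not typed in this module
((92) in abstract form: `B11Eq85FirstDerivative.hasFDerivAt92`); (93) enters as the DEFINITION `fd93 := D*(½ • icomm)`.
(ii) «the other terms … obtained by replacing some A′ in the commutator by −HD(A′)» and «… estimated by O(1)ε₃²(Lʲη)⁻³,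
if the covariant derivative in (39) acts on HD(A′)» are not modelled (they need the operators H, D of Sect. C).
(iii) All bounds are GLOBAL (every bond) where print localises to Ω_j, for `U1`-valued `U₀`; print's O(1) are certified
as `8(d − 1)`, `16(d − 1)`, `24(d − 1)`, its strict `<` of (77) as `≤`.  (iv) Nothing here is progress on the summit
`Summit.QuantumFields` — the value is a kernel certificate that (93)–(96) ARE (1.50)–(1.53) of [6] at B11's letters.
Unit `lit-balaban-r08` gen 2 (row `B11.Eq85` of `HOME/lit-balaban-r08/ROWS-B11.md`, HOME = `run/shared/lean/pub/lit-balaban/`).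
-/

noncomputable section

open scoped BigOperators
open Finset

namespace Literature.MathematicalPhysics.QuantumFieldTheory.Balaban1983to89.B11Eq93Commutator

open B7Prop1Explicit
open B8Ineq132 (covDeriv covDerivFwd norm_conjR_le)
open B8Eq143PlaqExpansion
open B8Eq146AExpansion
open B8Eq151V2Divergence

-- `Site` alone would resolve to the torus sites of `Setup.lean`; re-export the `ℤ^d` sites of `B7Prop1Explicit`.
export B7Prop1Explicit (Site)

variable {d : ℕ}

/-! ## §1 Algebra: the commutator sum `Σ_{b₁≺b₂} i[A″(b₁), A″(b₂)]`, (91), **(94)**, **(96)**, **(95)** -/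
section Algebra

variable {𝔸 : Type*} [NormedRing 𝔸] [NormedAlgebra ℂ 𝔸]

/-- `Σ_{b₁≺b₂} i[A″(b₁), A″(b₂)]` for the plaquette `p_{μν}(x)` — the commutator sum of (39)/(91) WITH the factor
`i`, as a plaquette function: `I • {…}`, `{…}` = the bracket of (1.49)–(1.50) of [6] (`B8Eq151V2Divergence.brk`:
`[x₁,x₂] + [x₁,x₃] + [x₁,x₄] + [x₂,x₃] + [x₂,x₄] + [x₃,x₄]` on the transported bond variables `A″(bᵢ) = xᵢ`).
[cite: Balaban1985Variational, (91) p.292] -/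
def icomm (U₀ : Site d → Fin d → 𝔸ˣ) (A : Site d → Fin d → 𝔸) : Fin d → Fin d → Site d → 𝔸 :=
  fun μ ν x => (Complex.I : ℂ) • brk U₀ A μ ν x

/-- Unfolding `icomm`. [cite: Balaban1985Variational, (91) p.292] -/
theorem icomm_apply (U₀ : Site d → Fin d → 𝔸ˣ) (A : Site d → Fin d → 𝔸) (μ ν : Fin d) (x : Site d) :
    icomm U₀ A μ ν x = (Complex.I : ℂ) • brk U₀ A μ ν x := rfl

/-- `icomm = I • brk` as plaquette functions. [cite: Balaban1985Variational, (91) p.292] -/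
theorem icomm_eq_smul (U₀ : Site d → Fin d → 𝔸ˣ) (A : Site d → Fin d → 𝔸) :
    icomm U₀ A = (Complex.I : ℂ) • brk U₀ A := rfl

/-- The pairing `⟨F, G⟩ = Σ_{p∈Ω₀} η^d tr F(p)G(p)` of plaquette functions over a finite plaquette set `P` (plaquettes
`p_{μν}(x)` as triples `(μ, ν, x)`), «tr» an arbitrary `ℂ`-linear functional `τ`.
[cite: Balaban1985Variational, (91) p.292] -/
def pairing (τ : 𝔸 →ₗ[ℂ] ℂ) (η : ℝ) (P : Finset (Fin d × Fin d × Site d)) (F G : Fin d → Fin d → Site d → 𝔸) : ℂ :=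
  ∑ p ∈ P, (η : ℂ) ^ d * τ (F p.1 p.2.1 p.2.2 * G p.1 p.2.1 p.2.2)

/-- **(91)**: `Σ_{p∈Ω₀} η^d ½ tr(DA′)(p) Σ_{b₁≺b₂} i[A″(b₁), A″(b₂)] = ½⟨DA′, Σi[A″, A″]⟩` — the typical cubic term of
the first expression of (39) after the change of variables (47), written with the pairing.
[cite: Balaban1985Variational, (91) p.292] -/
theorem eq91 (τ : 𝔸 →ₗ[ℂ] ℂ) (η : ℝ) (P : Finset (Fin d × Fin d × Site d)) (U₀ : Site d → Fin d → 𝔸ˣ)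
    (A : Site d → Fin d → 𝔸) :
    ∑ p ∈ P, (η : ℂ) ^ d * ((2 : ℂ)⁻¹ *
        τ (plaqCovDeriv η U₀ A p.1 p.2.1 p.2.2 * icomm U₀ A p.1 p.2.1 p.2.2)) =
      (2 : ℂ)⁻¹ * pairing τ η P (plaqCovDeriv η U₀ A) (icomm U₀ A) := by
  rw [pairing, Finset.mul_sum]
  refine Finset.sum_congr rfl fun p _ => ?_
  ring

/-- **(94)** EXACTLY — (1.50) of [6] multiplied by `i`, for an arbitrary bond field `A′` at the plaquette `p_{μν}(x)`
(`η ≠ 0`): `Σ_{b₁≺b₂} i[A″(b₁), A″(b₂)] = 2i[A′_μ(x), A′_ν(x)] + 2iη[A′_μ(x), (D_μA′_ν)(x)] + 2iη[(D_νA′_μ)(x), A′_ν(x)]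
− iη[A′_μ(x), (D_νA′_μ)(x)] − iη[(D_μA′_ν)(x), A′_ν(x)] − iη²[(D_μA′_ν)(x), (D_νA′_μ)(x)]`.
[cite: Balaban1985Variational, (94) p.292] -/
theorem eq94 {η : ℝ} (hη : η ≠ 0) (U₀ : Site d → Fin d → 𝔸ˣ) (A : Site d → Fin d → 𝔸) (μ ν : Fin d)
    (x : Site d) :
    icomm U₀ A μ ν x =
      2 * ((Complex.I : ℂ) • adR (A x μ) (A x ν))
        + 2 * ((Complex.I : ℂ) • (η • adR (A x μ) (covDerivFwd η U₀ μ (fun y => A y ν) x)))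
        + 2 * ((Complex.I : ℂ) • (η • adR (covDerivFwd η U₀ ν (fun y => A y μ) x) (A x ν)))
        - (Complex.I : ℂ) • (η • adR (A x μ) (covDerivFwd η U₀ ν (fun y => A y μ) x))
        - (Complex.I : ℂ) • (η • adR (covDerivFwd η U₀ μ (fun y => A y ν) x) (A x ν))
        - (Complex.I : ℂ) • (η ^ 2 • adR (covDerivFwd η U₀ μ (fun y => A y ν) x)
            (covDerivFwd η U₀ ν (fun y => A y μ) x)) := by
  rw [icomm_apply, eq150 hη]
  simp only [smul_add, smul_sub, mul_smul_comm]

/-- **(96)** EXACTLY — (1.52) of [6] at print's letters (`η ≠ 0`):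
`(D*_ν[A′_μ, A′_ν])(x) = η[(D*_νA′_μ)(x), (D*_νA′_ν)(x)] + [(D*_νA′_μ)(x), A′_ν(x)] + [A′_μ(x), (D*_νA′_ν)(x)]`.
[cite: Balaban1985Variational, (96) p.292] -/
theorem eq96 {η : ℝ} (hη : η ≠ 0) (U₀ : Site d → Fin d → 𝔸ˣ) (A : Site d → Fin d → 𝔸) (μ ν : Fin d)
    (x : Site d) :
    covDeriv η U₀ ν (fun y => adR (A y μ) (A y ν)) x =
      η • adR (covDeriv η U₀ ν (fun y => A y μ) x) (covDeriv η U₀ ν (fun y => A y ν) x)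
        + adR (covDeriv η U₀ ν (fun y => A y μ) x) (A x ν)
        + adR (A x μ) (covDeriv η U₀ ν (fun y => A y ν) x) :=
  eq152 hη U₀ (fun y => A y μ) (fun y => A y ν) ν x

/-- **(93)**: the functional derivative `½D*Σi[A″, A″]` at the bond `⟨x, x + ηe_μ⟩` — the divergence (1.2) of [6] of
the plaquette function `½Σ_{b₁≺b₂} i[A″(b₁), A″(b₂)]`. [cite: Balaban1985Variational, (93) p.292] -/
def fd93 (η : ℝ) (U₀ : Site d → Fin d → 𝔸ˣ) (A : Site d → Fin d → 𝔸) (μ : Fin d) (x : Site d) : 𝔸 :=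
  pdiv η U₀ ((2 : ℂ)⁻¹ • icomm U₀ A) μ x

/-- «Applying D* to the first term» of (94): `½D*` of the plaquette function `2i[A′_μ(x), A′_ν(x)]`.
[cite: Balaban1985Variational, (95) p.292] -/
def fd95 (η : ℝ) (U₀ : Site d → Fin d → 𝔸ˣ) (A : Site d → Fin d → 𝔸) (μ : Fin d) (x : Site d) : 𝔸 :=
  pdiv η U₀ ((2 : ℂ)⁻¹ • ((Complex.I : ℂ) • brk0 A)) μ x

/-- `(2 : ℂ)⁻¹ • (I • (2Y)) = I • Y`. [folklore] -/
private theorem half_smul_I_smul_two_mul (Y : 𝔸) :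
    (2 : ℂ)⁻¹ • ((Complex.I : ℂ) • (2 * Y)) = (Complex.I : ℂ) • Y := by
  have h2 : (2 : 𝔸) * Y = (2 : ℂ) • Y := by rw [two_mul, two_smul]
  rw [h2, smul_comm (Complex.I : ℂ) (2 : ℂ) Y, smul_smul, inv_mul_cancel₀ two_ne_zero, one_smul]

/-- **(95)** EXACTLY: `½D*(2i[A′_·, A′_·])_μ(x) = i Σ_{ν<μ} (D*_ν[A′_ν, A′_μ])(x) − i Σ_{ν>μ} (D*_ν[A′_μ, A′_ν])(x)`
((1.2) of [6]: `(D*F)_μ = Σ_{ν<μ}D*_νF_{νμ} − Σ_{ν>μ}D*_νF_{μν}`, with `F_{νμ} = 2i[A′_ν, A′_μ]`).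
[cite: Balaban1985Variational, (95) p.292] -/
theorem eq95 (η : ℝ) (U₀ : Site d → Fin d → 𝔸ˣ) (A : Site d → Fin d → 𝔸) (μ : Fin d) (x : Site d) :
    fd95 η U₀ A μ x =
      (Complex.I : ℂ) • ∑ ν ∈ Finset.Iio μ, covDeriv η U₀ ν (fun y => adR (A y ν) (A y μ)) x
        - (Complex.I : ℂ) • ∑ ν ∈ Finset.Ioi μ, covDeriv η U₀ ν (fun y => adR (A y μ) (A y ν)) x := by
  have h1 : ∀ κ τ : Fin d, covDeriv η U₀ κ (brk0 A κ τ) x = 2 * covDeriv η U₀ κ (fun y => adR (A y κ) (A y τ)) x :=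
    fun κ τ => covDeriv_two_mul η U₀ κ (fun y => adR (A y κ) (A y τ)) x
  have h2 : ∀ κ τ : Fin d, covDeriv η U₀ κ (brk0 A τ κ) x = 2 * covDeriv η U₀ κ (fun y => adR (A y τ) (A y κ)) x :=
    fun κ τ => covDeriv_two_mul η U₀ κ (fun y => adR (A y τ) (A y κ)) x
  rw [fd95, pdiv_smul, pdiv_smul, pdiv]
  simp only [h1, h2, ← Finset.mul_sum, ← mul_sub, half_smul_I_smul_two_mul, smul_sub]

/-- (95) agrees with the main term of (1.51) of [6]: `½D*(2i[A′_·, A′_·])_μ(x) = −i Σ_{ν≠μ} (D*_ν[A′_μ, A′_ν])(x)`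
(`[A′_ν, A′_μ] = −[A′_μ, A′_ν]`; `B8Eq151V2Divergence.pdiv_brk0`). [cite: Balaban1985Variational, (95) p.292] -/
theorem fd95_eq_neg_sum (η : ℝ) (U₀ : Site d → Fin d → 𝔸ˣ) (A : Site d → Fin d → 𝔸) (μ : Fin d) (x : Site d) :
    fd95 η U₀ A μ x =
      -((Complex.I : ℂ) • ∑ ν ∈ Finset.univ.erase μ, covDeriv η U₀ ν (fun y => adR (A y μ) (A y ν)) x) := by
  rw [fd95, pdiv_smul, pdiv_smul, pdiv_brk0, smul_neg, smul_neg, half_smul_I_smul_two_mul]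

/-- `D*` is subtractive on plaquette functions (from `pdiv_add`, `pdiv_smul`). [folklore] -/
private theorem pdiv_sub (η : ℝ) (V : Site d → Fin d → 𝔸ˣ) (F G : Fin d → Fin d → Site d → 𝔸) (μ : Fin d) (x : Site d) :
    pdiv η V (F - G) μ x = pdiv η V F μ x - pdiv η V G μ x := by
  rw [sub_eq_add_neg F G, ← neg_one_smul ℂ G, pdiv_add, pdiv_smul, neg_one_smul, ← sub_eq_add_neg]

/-- «these terms in (93)» (all but the first of (94)) are `½D*` of `i({…} − 2[A′_μ, A′_ν])`:
`fd93 − fd95 = D*(½ • I • (brk − brk0))`. [cite: Balaban1985Variational, (93)-(95) p.292] -/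
theorem fd93_sub_fd95 (η : ℝ) (U₀ : Site d → Fin d → 𝔸ˣ) (A : Site d → Fin d → 𝔸) (μ : Fin d) (x : Site d) :
    fd93 η U₀ A μ x - fd95 η U₀ A μ x =
      (2 : ℂ)⁻¹ • ((Complex.I : ℂ) • pdiv η U₀ (brk U₀ A - brk0 A) μ x) := by
  rw [fd93, fd95, icomm_eq_smul, pdiv_smul, pdiv_smul, pdiv_smul, pdiv_smul, pdiv_sub, smul_sub, smul_sub]

end Algebra

/-! ## §2 The estimates «O(1)|∇A′||A′|» with the O(1) explicit -/
section Bounds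

variable {𝔸 : Type*} [NormedRing 𝔸] [NormOneClass 𝔸] [NormedAlgebra ℂ 𝔸]

omit [NormOneClass 𝔸] [NormedAlgebra ℂ 𝔸] in
/-- `|B + C − D − E − F| ≤ |B| + |C| + |D| + |E| + |F|`. [folklore] -/
private theorem norm_five_le (B C D E F : 𝔸) : ‖B + C - D - E - F‖ ≤ ‖B‖ + ‖C‖ + ‖D‖ + ‖E‖ + ‖F‖ := by
  have h1 := norm_sub_le (B + C - D - E) F
  have h2 := norm_sub_le (B + C - D) E
  have h3 := norm_sub_le (B + C) D
  have h4 := norm_add_le B C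
  linarith

omit [NormOneClass 𝔸] in
/-- `‖(2 : ℂ)⁻¹ • (I • Y)‖ = ½‖Y‖`. [folklore] -/
private theorem norm_half_smul_I_smul (Y : 𝔸) : ‖(2 : ℂ)⁻¹ • ((Complex.I : ℂ) • Y)‖ = 2⁻¹ * ‖Y‖ := by
  rw [norm_smul, norm_smul, norm_inv, Complex.norm_two, Complex.norm_I, one_mul]

/-- THE FIVE `η`-TERMS OF (94) PER PLAQUETTE: for `U1`-valued `U₀`, `|A′| ≤ a`, `|∇A′| ≤ G` on all bonds, `η > 0`:
`‖{…} − 2[A′_μ(x), A′_ν(x)]‖ ≤ 16η·a·G` (`(4 + 4 + 2 + 2 + 4)ηaG`; the `η²`-term via `|η(D_μA′_ν)(x)| ≤ 2a`) — «we can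
use the factor η». [cite: Balaban1985Variational, (94) p.292] -/
theorem norm_brk_sub_brk0_le {η : ℝ} (hη : 0 < η) {U₀ : Site d → Fin d → 𝔸ˣ} (h₀ : ∀ y κ, U₀ y κ ∈ U1 𝔸)
    {A : Site d → Fin d → 𝔸} {a G : ℝ} (hA : ∀ y κ, ‖A y κ‖ ≤ a)
    (hG : ∀ (y : Site d) (κ τ : Fin d), ‖covDerivFwd η U₀ κ (fun z => A z τ) y‖ ≤ G) (μ ν : Fin d) (x : Site d) :
    ‖brk U₀ A μ ν x - brk0 A μ ν x‖ ≤ 16 * η * a * G := by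
  rw [eq150 hη.ne', brk0_apply]
  set P' := covDerivFwd η U₀ μ (fun y => A y ν) x with hP'def
  set Q' := covDerivFwd η U₀ ν (fun y => A y μ) x with hQ'def
  have ha0 : 0 ≤ a := (norm_nonneg _).trans (hA x μ)
  have hG0 : 0 ≤ G := (norm_nonneg _).trans (hG x μ ν)
  have ha := hA x μ
  have hb := hA x ν
  have hP : ‖P'‖ ≤ G := hG x μ ν
  have hQ : ‖Q'‖ ≤ G := hG x ν μ
  have hηP : ‖η • P'‖ ≤ 2 * a := norm_eta_smul_covDerivFwd_le hη.ne' h₀ hA x μ ν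
  have hsn : ∀ Z : 𝔸, ‖η • Z‖ = η * ‖Z‖ := fun Z => by rw [norm_smul, Real.norm_of_nonneg hη.le]
  have t2 : ‖2 * (η • adR (A x μ) P')‖ ≤ 2 * (η * (2 * a * G)) := by
    refine (norm_two_mul_le _).trans (mul_le_mul_of_nonneg_left ?_ zero_le_two)
    rw [hsn]
    exact mul_le_mul_of_nonneg_left (norm_adR_le_of_le ha hP) hη.le
  have t3 : ‖2 * (η • adR Q' (A x ν))‖ ≤ 2 * (η * (2 * G * a)) := by
    refine (norm_two_mul_le _).trans (mul_le_mul_of_nonneg_left ?_ zero_le_two)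
    rw [hsn]
    exact mul_le_mul_of_nonneg_left (norm_adR_le_of_le hQ hb) hη.le
  have t4 : ‖η • adR (A x μ) Q'‖ ≤ η * (2 * a * G) := by
    rw [hsn]
    exact mul_le_mul_of_nonneg_left (norm_adR_le_of_le ha hQ) hη.le
  have t5 : ‖η • adR P' (A x ν)‖ ≤ η * (2 * G * a) := by
    rw [hsn]
    exact mul_le_mul_of_nonneg_left (norm_adR_le_of_le hP hb) hη.le
  have t6 : ‖η ^ 2 • adR P' Q'‖ ≤ η * (2 * (2 * a) * G) := by
    rw [sq, ← smul_smul, ← adR_smul_left_real η P' Q', hsn]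
    exact mul_le_mul_of_nonneg_left (norm_adR_le_of_le hηP hQ) hη.le
  have heq : 2 * adR (A x μ) (A x ν) + 2 * (η • adR (A x μ) P') + 2 * (η • adR Q' (A x ν)) - η • adR (A x μ) Q'
        - η • adR P' (A x ν) - η ^ 2 • adR P' Q' - 2 * adR (A x μ) (A x ν) =
      2 * (η • adR (A x μ) P') + 2 * (η • adR Q' (A x ν)) - η • adR (A x μ) Q' - η • adR P' (A x ν)
        - η ^ 2 • adR P' Q' := by abel
  rw [heq]
  refine (norm_five_le _ _ _ _ _).trans ?_
  nlinarith [t2, t3, t4, t5, t6]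

/-- `D*` of the five `η`-terms: `‖D*({…} − 2[A′_·, A′_·])_μ(x)‖ ≤ 32(d − 1)·a·G` («we can use the factor η to replace
this derivative by a simple difference operation»: `|D*_νF(x)| ≤ η⁻¹(|F(x − e_ν)| + |F(x)|)`, `d − 1` directions).
[cite: Balaban1985Variational, (93)-(94) p.292] -/
theorem norm_pdiv_brk_sub_brk0_le {η : ℝ} (hη : 0 < η) {U₀ : Site d → Fin d → 𝔸ˣ} (h₀ : ∀ y κ, U₀ y κ ∈ U1 𝔸)
    {A : Site d → Fin d → 𝔸} {a G : ℝ} (hA : ∀ y κ, ‖A y κ‖ ≤ a)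
    (hG : ∀ (y : Site d) (κ τ : Fin d), ‖covDerivFwd η U₀ κ (fun z => A z τ) y‖ ≤ G) (μ : Fin d) (x : Site d) :
    ‖pdiv η U₀ (brk U₀ A - brk0 A) μ x‖ ≤ 32 * ((d : ℝ) - 1) * a * G := by
  have hR : ∀ (κ τ : Fin d) (y : Site d), ‖(brk U₀ A - brk0 A) κ τ y‖ ≤ 16 * η * a * G := fun κ τ y => by
    simp only [Pi.sub_apply]
    exact norm_brk_sub_brk0_le hη h₀ hA hG κ τ y
  have h1 : η⁻¹ * η = 1 := inv_mul_cancel₀ hη.ne'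
  unfold pdiv
  calc _ ≤ ((d : ℝ) - 1) * (η⁻¹ * (16 * η * a * G + 16 * η * a * G)) := by
        refine norm_sub_sums_le (fun ν _ => ?_) (fun ν _ => ?_)
        · exact (norm_covDeriv_le hη (h₀ _ _) _).trans
            (mul_le_mul_of_nonneg_left (add_le_add (hR _ _ _) (hR _ _ _)) (inv_nonneg.mpr hη.le))
        · exact (norm_covDeriv_le hη (h₀ _ _) _).trans
            (mul_le_mul_of_nonneg_left (add_le_add (hR _ _ _) (hR _ _ _)) (inv_nonneg.mpr hη.le))
    _ = 32 * ((d : ℝ) - 1) * a * G * (η⁻¹ * η) := by ring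
    _ = 32 * ((d : ℝ) - 1) * a * G := by rw [h1, mul_one]

/-- «Thus these terms in (93) can be estimated by O(1)|∇A′||A′|»: `‖fd93 − fd95‖ ≤ 16(d − 1)·a·G`.
[cite: Balaban1985Variational, (93)-(94) p.292] -/
theorem norm_fd93_sub_fd95_le {η : ℝ} (hη : 0 < η) {U₀ : Site d → Fin d → 𝔸ˣ} (h₀ : ∀ y κ, U₀ y κ ∈ U1 𝔸)
    {A : Site d → Fin d → 𝔸} {a G : ℝ} (hA : ∀ y κ, ‖A y κ‖ ≤ a)
    (hG : ∀ (y : Site d) (κ τ : Fin d), ‖covDerivFwd η U₀ κ (fun z => A z τ) y‖ ≤ G) (μ : Fin d) (x : Site d) :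
    ‖fd93 η U₀ A μ x - fd95 η U₀ A μ x‖ ≤ 16 * ((d : ℝ) - 1) * a * G := by
  rw [fd93_sub_fd95, norm_half_smul_I_smul]
  have h := norm_pdiv_brk_sub_brk0_le hη h₀ hA hG μ x
  linarith

/-- (96) termwise for the `ν < μ` summands of (95): `|D*_ν[A′_ν, A′_μ](x)| = |D*_ν[A′_μ, A′_ν](x)| ≤ 8aG`
(`[A′_ν, A′_μ] = −[A′_μ, A′_ν]`). [cite: Balaban1985Variational, (95)-(96) p.292] -/
theorem norm_covDeriv_adR_swap_le {η : ℝ} (hη : 0 < η) {U₀ : Site d → Fin d → 𝔸ˣ} (h₀ : ∀ y κ, U₀ y κ ∈ U1 𝔸)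
    {A : Site d → Fin d → 𝔸} {a G : ℝ} (hA : ∀ y κ, ‖A y κ‖ ≤ a)
    (hG : ∀ (y : Site d) (κ τ : Fin d), ‖covDerivFwd η U₀ κ (fun z => A z τ) y‖ ≤ G) (μ ν : Fin d) (x : Site d) :
    ‖covDeriv η U₀ ν (fun y => adR (A y ν) (A y μ)) x‖ ≤ 8 * a * G := by
  have h : (fun y => adR (A y ν) (A y μ)) = fun y => -adR (A y μ) (A y ν) := funext fun y => adR_swap _ _
  rw [h, covDeriv_neg, norm_neg]
  exact norm_covDeriv_adR_le hη h₀ hA hG μ ν x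

/-- «From this it follows that the expression (95) can be estimated by O(1)|∇A′||A′| also»: by (96) termwise
(`|D*_ν[A′_μ, A′_ν](x)| ≤ 8aG`, `B8Eq151V2Divergence.norm_covDeriv_adR_le`) and `d − 1` directions,
`‖(95)‖ ≤ 8(d − 1)·a·G`. [cite: Balaban1985Variational, (95)-(96) p.292] -/
theorem norm_fd95_le {η : ℝ} (hη : 0 < η) {U₀ : Site d → Fin d → 𝔸ˣ} (h₀ : ∀ y κ, U₀ y κ ∈ U1 𝔸)
    {A : Site d → Fin d → 𝔸} {a G : ℝ} (hA : ∀ y κ, ‖A y κ‖ ≤ a)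
    (hG : ∀ (y : Site d) (κ τ : Fin d), ‖covDerivFwd η U₀ κ (fun z => A z τ) y‖ ≤ G) (μ : Fin d) (x : Site d) :
    ‖fd95 η U₀ A μ x‖ ≤ 8 * ((d : ℝ) - 1) * a * G := by
  rw [eq95, ← smul_sub, norm_smul, Complex.norm_I, one_mul]
  exact (norm_sub_sums_le (fun ν _ => norm_covDeriv_adR_swap_le hη h₀ hA hG μ ν x)
    (fun ν _ => norm_covDeriv_adR_le hη h₀ hA hG μ ν x)).trans (le_of_eq (by ring))

/-- **(93) estimated**: `‖½D*Σi[A″, A″]_μ(x)‖ ≤ 24(d − 1)·a·G` (`16 + 8`) for `U1`-valued `U₀`, `|A′| ≤ a`,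
`|∇A′| ≤ G`, `η > 0` — the commutator term's share of (97). [cite: Balaban1985Variational, (93)-(96) p.292] -/
theorem norm_fd93_le {η : ℝ} (hη : 0 < η) {U₀ : Site d → Fin d → 𝔸ˣ} (h₀ : ∀ y κ, U₀ y κ ∈ U1 𝔸)
    {A : Site d → Fin d → 𝔸} {a G : ℝ} (hA : ∀ y κ, ‖A y κ‖ ≤ a)
    (hG : ∀ (y : Site d) (κ τ : Fin d), ‖covDerivFwd η U₀ κ (fun z => A z τ) y‖ ≤ G) (μ : Fin d) (x : Site d) :
    ‖fd93 η U₀ A μ x‖ ≤ 24 * ((d : ℝ) - 1) * a * G := by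
  have h1 := norm_fd93_sub_fd95_le hη h₀ hA hG μ x
  have h2 := norm_fd95_le hη h₀ hA hG μ x
  calc ‖fd93 η U₀ A μ x‖ = ‖(fd93 η U₀ A μ x - fd95 η U₀ A μ x) + fd95 η U₀ A μ x‖ := by rw [sub_add_cancel]
    _ ≤ ‖fd93 η U₀ A μ x - fd95 η U₀ A μ x‖ + ‖fd95 η U₀ A μ x‖ := norm_add_le _ _
    _ ≤ 16 * ((d : ℝ) - 1) * a * G + 8 * ((d : ℝ) - 1) * a * G := add_le_add h1 h2
    _ = 24 * ((d : ℝ) - 1) * a * G := by ring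

/-- **(93) under (77)**: with `|A′| ≤ ε₃(Lʲη)⁻¹`, `|∇A′| ≤ ε₃(Lʲη)⁻²` (print: strict, on Ω_j; here `t = Lʲη`, global)
the commutator term is `≤ 24(d − 1)ε₃²(Lʲη)⁻³` — «O(1)|∇A′||A′|» in the `O(1)ε₃²(Lʲη)⁻³` form of (97).
[cite: Balaban1985Variational, (93)-(97) pp.292-293] -/
theorem norm_fd93_le_eps3 {η : ℝ} (hη : 0 < η) {U₀ : Site d → Fin d → 𝔸ˣ} (h₀ : ∀ y κ, U₀ y κ ∈ U1 𝔸)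
    {A : Site d → Fin d → 𝔸} {ε₃ t : ℝ} (hA : ∀ y κ, ‖A y κ‖ ≤ ε₃ * t⁻¹)
    (hG : ∀ (y : Site d) (κ τ : Fin d), ‖covDerivFwd η U₀ κ (fun z => A z τ) y‖ ≤ ε₃ * t⁻¹ ^ 2) (μ : Fin d)
    (x : Site d) :
    ‖fd93 η U₀ A μ x‖ ≤ 24 * ((d : ℝ) - 1) * ε₃ ^ 2 * t⁻¹ ^ 3 := by
  have h := norm_fd93_le hη h₀ hA hG μ x
  calc ‖fd93 η U₀ A μ x‖ ≤ 24 * ((d : ℝ) - 1) * (ε₃ * t⁻¹) * (ε₃ * t⁻¹ ^ 2) := h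
    _ = 24 * ((d : ℝ) - 1) * ε₃ ^ 2 * t⁻¹ ^ 3 := by ring

end Bounds

end Literature.MathematicalPhysics.QuantumFieldTheory.Balaban1983to89.B11Eq93Commutator
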